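import Literature.NumberTheory.Sieve.ShiuUniform
import Literature.NumberTheory.Sieve.RoughDivisorPowerSums
import Literature.NumberTheory.Sieve.DivisorBound
import HarnessLib

/-!
# Divisor moments over rough numbers: `∑_{n ≤ X, (n, P(z)) = 1} τ(n)^k ≪_k X (log X/log z)^{2^k}/log X`

Topic `Literature/NumberTheory/Sieve`. Everything in this file is PROVED; no definition is introduced
(the function `f_z(n) = τ(n)^k 𝟙_{(n, P(z)) = 1}` is written out). From Shiu's theorem, uniformly in
the function (`shiu_uniform`), applied to the multiplicative family `f_z` (`f_z(p^l) ≤ (2^k)^l`,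
`f_z(n) ≤ A₂(δ) n^δ` by the divisor bound), whose Euler exponent is
`∑_{p ≤ x} f_z(p)/p = 2^k ∑_{z ≤ p ≤ x} 1/p ≤ 2^k (log(log x/log z) + 25)` (the tree's
`RoughSums.sum_primesGe_inv_le`):

* `RoughMoments.block_bound` — `∑_{x < n ≤ 2x, (n,P(z))=1} τ(n)^k ≤ C x (log x/log z)^{2^k}/log x` for
  `x ≥ x₀(k)`, `1 < z ≤ x`;
* `RoughMoments.sum_le` — `∑_{n ≤ X, (n,P(z))=1} τ(n)^k ≤ C X (log X/log z)^{2^k}/log X` for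
  `2 ≤ z`, `z² ≤ X` (dyadic blocks down to `√X`, the initial segment by the divisor bound).

This is the one-variable half of the Cauchy–Schwarz route to the divisor-weighted pair bounds of
Matomäki–Merikoski (arXiv:2112.11412) Lemma 3.1, there obtained from Henriot's Nair–Tenenbaum theorem.

## References

* P. Shiu, J. reine angew. Math. 313 (1980), 161–170, Theorem 1. [cite: Shiu1980, Theorem 1]
* K. Matomäki, J. Merikoski, IMRN 2023 (arXiv:2112.11412), §3.1 (Lemma 3.1 and (eq:f(n)/n_average)).
  [cite: MatomakiMerikoski2023, §3.1]
-/

noncomputable section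

open Finset Real
open scoped ArithmeticFunction.sigma

namespace Literature.NumberTheory.Sieve

namespace RoughMoments

/-! ### The multiplicative family `f_z(n) = τ(n)^k 𝟙_{(n,P(z))=1}` -/

/-- `f_z(mn) = f_z(m) f_z(n)` for coprime `m, n`. [folklore] -/
theorem mul_of_coprime (k : ℕ) (z : ℝ) {m n : ℕ} (hmn : m.Coprime n) :
    ((σ 0 (m * n) : ℕ) : ℝ) ^ k * (if (m * n).Coprime (primesProdBelow z) then (1 : ℝ) else 0) =
      (((σ 0 m : ℕ) : ℝ) ^ k * (if m.Coprime (primesProdBelow z) then (1 : ℝ) else 0)) *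
        (((σ 0 n : ℕ) : ℝ) ^ k * (if n.Coprime (primesProdBelow z) then (1 : ℝ) else 0)) := by
  rw [ArithmeticFunction.isMultiplicative_sigma.map_mul_of_coprime hmn, Nat.cast_mul, mul_pow]
  by_cases hm : m.Coprime (primesProdBelow z) <;> by_cases hn : n.Coprime (primesProdBelow z)
  · rw [if_pos hm, if_pos hn, if_pos (Nat.Coprime.mul_left hm hn)]; ring
  · rw [if_pos hm, if_neg hn, if_neg (fun h => hn (Nat.Coprime.coprime_mul_left h))]; ring
  · rw [if_neg hm, if_neg (fun h => hm (Nat.Coprime.coprime_mul_right h))]; ring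
  · rw [if_neg hm, if_neg (fun h => hm (Nat.Coprime.coprime_mul_right h))]; ring

/-- `f_z(p^l) ≤ (2^k)^l` (`τ(p^l) = l + 1 ≤ 2^l`). [folklore] -/
theorem prime_pow_le (k : ℕ) (z : ℝ) {p l : ℕ} (hp : p.Prime) :
    ((σ 0 (p ^ l) : ℕ) : ℝ) ^ k * (if (p ^ l).Coprime (primesProdBelow z) then (1 : ℝ) else 0) ≤
      ((2 : ℝ) ^ k) ^ l := by
  rw [ArithmeticFunction.sigma_zero_apply_prime_pow hp]
  have h1 : ((l + 1 : ℕ) : ℝ) ≤ (2 : ℝ) ^ l := by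
    have := Nat.lt_two_pow_self (n := l)
    exact_mod_cast this
  have h2 : (((l + 1 : ℕ) : ℝ)) ^ k ≤ ((2 : ℝ) ^ l) ^ k := pow_le_pow_left₀ (by positivity) h1 k
  calc ((l + 1 : ℕ) : ℝ) ^ k * (if (p ^ l).Coprime (primesProdBelow z) then (1 : ℝ) else 0)
      ≤ ((l + 1 : ℕ) : ℝ) ^ k * 1 := by
        refine mul_le_mul_of_nonneg_left ?_ (by positivity)
        split_ifs <;> norm_num
    _ ≤ ((2 : ℝ) ^ l) ^ k := by rw [mul_one]; exact h2
    _ = ((2 : ℝ) ^ k) ^ l := by rw [← pow_mul, ← pow_mul, mul_comm]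

/-- The divisor-bound majorant: there is `A₂ : ℝ → ℝ` with `f_z(n) ≤ τ(n)^k ≤ A₂(δ) n^δ` for all
`δ > 0`, `n ≥ 1`, uniformly in `z`. [folklore] -/
theorem exists_rpow_majorant (k : ℕ) : ∃ A₂ : ℝ → ℝ, ∀ z : ℝ, ∀ δ : ℝ, 0 < δ → ∀ n : ℕ, 1 ≤ n →
    ((σ 0 n : ℕ) : ℝ) ^ k * (if n.Coprime (primesProdBelow z) then (1 : ℝ) else 0) ≤ A₂ δ * (n : ℝ) ^ δ := by
  classical
  -- for each `δ > 0` a constant `C_δ ≥ 1` with `τ(n) ≤ C_δ n^{δ/(k+1)}`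
  have hch : ∀ δ : ℝ, 0 < δ → ∃ C : ℝ, 1 ≤ C ∧ ∀ n : ℕ, ((σ 0 n : ℕ) : ℝ) ≤ C * (n : ℝ) ^ (δ / (k + 1)) :=
    fun δ hδ => exists_sigma_zero_le_mul_rpow (by positivity)
  refine ⟨fun δ => if h : 0 < δ then (Classical.choose (hch δ h)) ^ k else 0, ?_⟩
  intro z δ hδ n hn
  dsimp only
  rw [dif_pos hδ]
  obtain ⟨hC1, hC⟩ := Classical.choose_spec (hch δ hδ)
  set C := Classical.choose (hch δ hδ) with hCdef
  have hn0 : (0 : ℝ) < n := by exact_mod_cast hn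
  have hτ : ((σ 0 n : ℕ) : ℝ) ^ k ≤ C ^ k * (n : ℝ) ^ δ := by
    calc ((σ 0 n : ℕ) : ℝ) ^ k ≤ (C * (n : ℝ) ^ (δ / (k + 1))) ^ k := pow_le_pow_left₀ (by positivity) (hC n) k
      _ = C ^ k * ((n : ℝ) ^ (δ / (k + 1))) ^ k := mul_pow _ _ _
      _ ≤ C ^ k * (n : ℝ) ^ δ := by
          refine mul_le_mul_of_nonneg_left ?_ (by positivity)
          rw [← Real.rpow_natCast, ← Real.rpow_mul hn0.le]
          refine Real.rpow_le_rpow_of_exponent_le (by exact_mod_cast hn) ?_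
          rw [div_mul_eq_mul_div, div_le_iff₀ (by positivity)]
          nlinarith
  calc ((σ 0 n : ℕ) : ℝ) ^ k * (if n.Coprime (primesProdBelow z) then (1 : ℝ) else 0)
      ≤ ((σ 0 n : ℕ) : ℝ) ^ k * 1 := by
        refine mul_le_mul_of_nonneg_left ?_ (by positivity)
        split_ifs <;> norm_num
    _ ≤ C ^ k * (n : ℝ) ^ δ := by rw [mul_one]; exact hτ

/-- The Euler exponent of `f_z`: `∑_{p ≤ x, p ∤ 1} f_z(p)/p ≤ 2^k (log(log x/log z) + 25)` for
`1 < z ≤ x`. [cite: MatomakiMerikoski2023, §3.1 (eq:Mertens)] -/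
theorem esum_le (k : ℕ) {z x : ℝ} (hz : 1 < z) (hzx : z ≤ x) :
    ∑ p ∈ (Finset.Icc 1 ⌊x⌋₊).filter (fun p : ℕ => p.Prime ∧ ¬p ∣ 1),
        ((σ 0 p : ℕ) : ℝ) ^ k * (if p.Coprime (primesProdBelow z) then (1 : ℝ) else 0) / p ≤
      (2 : ℝ) ^ k * (Real.log (Real.log x / Real.log z) + 25) := by
  have hwin := RoughSums.sum_primesGe_inv_le hz hzx
  -- termwise: `f_z(p)/p = 2^k [z ≤ p]/p`
  have hterm : ∀ p ∈ (Finset.Icc 1 ⌊x⌋₊).filter (fun p : ℕ => p.Prime ∧ ¬p ∣ 1),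
      ((σ 0 p : ℕ) : ℝ) ^ k * (if p.Coprime (primesProdBelow z) then (1 : ℝ) else 0) / p =
        (2 : ℝ) ^ k * (if z ≤ (p : ℝ) then (p : ℝ)⁻¹ else 0) := by
    intro p hp
    have hpp : p.Prime := (Finset.mem_filter.mp hp).2.1
    have hσ : σ 0 p = 2 := by
      have := ArithmeticFunction.sigma_zero_apply_prime_pow (i := 1) hpp
      rwa [pow_one] at this
    rw [hσ]
    have hcop : p.Coprime (primesProdBelow z) ↔ z ≤ (p : ℝ) := by
      rw [Nat.Prime.coprime_iff_not_dvd hpp, dvd_primesProdBelow_iff hpp, not_lt]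
    by_cases h : z ≤ (p : ℝ)
    · rw [if_pos (hcop.mpr h), if_pos h]; push_cast; ring
    · rw [if_neg (fun h' => h (hcop.mp h')), if_neg h]; simp
  rw [Finset.sum_congr rfl hterm, ← Finset.mul_sum, ← Finset.sum_filter]
  refine mul_le_mul_of_nonneg_left (le_trans ?_ hwin) (by positivity)
  refine Finset.sum_le_sum_of_subset_of_nonneg ?_ fun p _ _ => inv_nonneg.mpr (Nat.cast_nonneg p)
  intro p hp
  simp only [Finset.mem_filter, Finset.mem_Icc] at hp
  rw [Finset.mem_filter, Nat.mem_primesLE]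
  exact ⟨⟨hp.1.1.2, hp.1.2.1⟩, hp.2⟩

/-! ### Shiu on dyadic blocks -/

/-- **Block bound**: there are `C, x₀` (depending on `k`) such that for `x ≥ x₀`, `1 < z ≤ x`,
`∑_{x < n ≤ 2x, (n,P(z))=1} τ(n)^k ≤ C x (log x/log z)^{2^k}/log x`. [cite: Shiu1980, Theorem 1] -/
theorem block_bound (k : ℕ) : ∃ C x₀ : ℝ, 0 ≤ C ∧ 1 ≤ x₀ ∧ ∀ z x : ℝ, x₀ ≤ x → 1 < z → z ≤ x →
    ∑ n ∈ (Finset.Icc 1 ⌊x + x⌋₊).filter (fun n : ℕ => x < n),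
        ((σ 0 n : ℕ) : ℝ) ^ k * (if n.Coprime (primesProdBelow z) then (1 : ℝ) else 0) ≤
      C * x * (Real.log x / Real.log z) ^ (2 ^ k) / Real.log x := by
  obtain ⟨A₂, hA₂⟩ := exists_rpow_majorant k
  obtain ⟨C, x₀, hC0, hS⟩ := shiu_uniform (A₁ := (2 : ℝ) ^ k) (by positivity) A₂
    (ε := 1 / 4) (θ := 1 / 4) (by norm_num) (by norm_num) (by norm_num) (by norm_num)
  refine ⟨C * Real.exp (25 * 2 ^ k), max x₀ 2, by positivity, le_trans one_le_two (le_max_right _ _), ?_⟩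
  intro z x hx hz hzx
  have hx2 : 2 ≤ x := le_trans (le_max_right _ _) hx
  have hx0 : 0 < x := by linarith
  have hx1 : 1 < x := by linarith
  have hlogx : 0 < Real.log x := Real.log_pos hx1
  have hlogz : 0 < Real.log z := Real.log_pos hz
  set f : ℕ → ℝ := fun n => ((σ 0 n : ℕ) : ℝ) ^ k * (if n.Coprime (primesProdBelow z) then (1 : ℝ) else 0)
    with hf
  have hf0 : ∀ n, 0 ≤ f n := fun n => by
    simp only [hf]
    split_ifs <;> positivity
  have hmul : ∀ m n : ℕ, m.Coprime n → f (m * n) = f m * f n := fun m n h => mul_of_coprime k z h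
  have hpl : ∀ p l : ℕ, p.Prime → 1 ≤ l → f (p ^ l) ≤ ((2 : ℝ) ^ k) ^ l := fun p l hp _ => prime_pow_le k z hp
  have hmaj : ∀ δ : ℝ, 0 < δ → ∀ n : ℕ, 1 ≤ n → f n ≤ A₂ δ * (n : ℝ) ^ δ := fun δ hδ n hn => hA₂ z δ hδ n hn
  -- Shiu with `y = x`, `q = 1`, `a = 0`
  have hy : x ^ (1 / 4 : ℝ) ≤ x := by
    conv_rhs => rw [← Real.rpow_one x]
    exact Real.rpow_le_rpow_of_exponent_le hx1.le (by norm_num)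
  have hq : ((1 : ℕ) : ℝ) < x ^ (1 - 1 / 4 : ℝ) := by
    rw [Nat.cast_one]; exact Real.one_lt_rpow hx1 (by norm_num)
  have h := hS f hf0 hmul hpl hmaj x x (le_trans (le_max_left _ _) hx) hy le_rfl 1 le_rfl hq 0
    (Nat.coprime_one_right 0)
  -- simplify the progression condition modulo `1`
  have hset : (Finset.Icc 1 ⌊x + x⌋₊).filter (fun n : ℕ => x < n ∧ (n : ZMod 1) = ((0 : ℕ) : ZMod 1)) =
      (Finset.Icc 1 ⌊x + x⌋₊).filter (fun n : ℕ => x < n) := by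
    refine Finset.filter_congr fun n _ => ?_
    simp [Subsingleton.elim (n : ZMod 1) 0]
  rw [hset, Nat.totient_one, Nat.cast_one, one_mul] at h
  refine h.trans ?_
  -- the Euler factor
  have hE := esum_le k hz hzx
  have ht1 : 1 ≤ Real.log x / Real.log z := by
    rw [le_div_iff₀ hlogz, one_mul]; exact Real.log_le_log (by linarith) hzx
  have hexp : Real.exp (∑ p ∈ (Finset.Icc 1 ⌊x⌋₊).filter (fun p : ℕ => p.Prime ∧ ¬p ∣ 1), f p / p) ≤
      Real.exp (25 * 2 ^ k) * (Real.log x / Real.log z) ^ (2 ^ k) := by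
    calc Real.exp (∑ p ∈ (Finset.Icc 1 ⌊x⌋₊).filter (fun p : ℕ => p.Prime ∧ ¬p ∣ 1), f p / p)
        ≤ Real.exp ((2 : ℝ) ^ k * (Real.log (Real.log x / Real.log z) + 25)) := Real.exp_le_exp.mpr hE
      _ = Real.exp (25 * 2 ^ k) * (Real.log x / Real.log z) ^ (2 ^ k) := by
          rw [mul_add, Real.exp_add, mul_comm ((2 : ℝ) ^ k) (Real.log _), Real.exp_mul, Real.exp_log (by positivity)]
          rw [show ((2 : ℝ) ^ k) = ((2 ^ k : ℕ) : ℝ) by push_cast; ring, Real.rpow_natCast]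
          ring
  calc C * x / Real.log x * Real.exp (∑ p ∈ (Finset.Icc 1 ⌊x⌋₊).filter
          (fun p : ℕ => p.Prime ∧ ¬p ∣ 1), f p / p)
      ≤ C * x / Real.log x * (Real.exp (25 * 2 ^ k) * (Real.log x / Real.log z) ^ (2 ^ k)) :=
        mul_le_mul_of_nonneg_left hexp (by positivity)
    _ = C * Real.exp (25 * 2 ^ k) * x * (Real.log x / Real.log z) ^ (2 ^ k) / Real.log x := by
        field_simp

/-! ### The moment bound -/

/-- `X^{5/8} ≤ (8/3) X/log X` for `X > 1` (from `log t ≤ t − 1` at `t = X^{3/8}`). [folklore] -/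
theorem rpow_five_eighths_le {X : ℝ} (hX : 1 < X) :
    X ^ ((5 : ℝ) / 8) ≤ 8 / 3 * X / Real.log X := by
  have hX0 : 0 < X := by linarith
  have hlog : 0 < Real.log X := Real.log_pos hX
  set t : ℝ := X ^ ((3 : ℝ) / 8) with ht
  have ht0 : 0 < t := Real.rpow_pos_of_pos hX0 _
  have hlogt : Real.log t = 3 / 8 * Real.log X := by rw [ht, Real.log_rpow hX0]
  have h1 : 3 / 8 * Real.log X ≤ t := by
    have := Real.log_le_sub_one_of_pos ht0; rw [hlogt] at this; linarith
  have hsplit : X ^ ((5 : ℝ) / 8) * t = X := by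
    rw [ht, ← Real.rpow_add hX0]; norm_num
  rw [le_div_iff₀ hlog]
  calc X ^ ((5 : ℝ) / 8) * Real.log X = X ^ ((5 : ℝ) / 8) * (3 / 8 * Real.log X) * (8 / 3) := by ring
    _ ≤ X ^ ((5 : ℝ) / 8) * t * (8 / 3) := by
        refine mul_le_mul_of_nonneg_right (mul_le_mul_of_nonneg_left h1 (by positivity)) (by norm_num)
    _ = 8 / 3 * X := by rw [hsplit]; ring

/-- **Divisor moments over rough numbers** (one-variable Shiu input for Matomäki–Merikoski Lemma 3.1):
for every `k` there is `C` such that for `2 ≤ z`, `z² ≤ X`,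
`∑_{n ≤ X, (n,P(z))=1} τ(n)^k ≤ C X (log X/log z)^{2^k}/log X`.
Proof: dyadic blocks `(X/2^{j+1}, X/2^j]` with `X/2^{j+1} ≥ max(x₀, √X)` by `block_bound`
(`log(X/2^{j+1}) ≥ ½ log X`, `∑ 2^{−j} ≤ 2`), the initial segment `n ≤ 2 max(x₀, √X)` by the divisor
bound `τ(n)^k ≤ A n^{1/4}` and `X^{5/8} ≤ (8/3) X/log X`. [cite: MatomakiMerikoski2023, §3.1] -/
theorem sum_le (k : ℕ) : ∃ C : ℝ, 0 < C ∧ ∀ X z : ℝ, 2 ≤ z → z ^ 2 ≤ X →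
    ∑ n ∈ Finset.Icc 1 ⌊X⌋₊, ((σ 0 n : ℕ) : ℝ) ^ k * (if n.Coprime (primesProdBelow z) then (1 : ℝ) else 0) ≤
      C * X * (Real.log X / Real.log z) ^ (2 ^ k) / Real.log X := by
  obtain ⟨Cb, x₀, hCb, hx₀, hblock⟩ := block_bound k
  obtain ⟨A₂, hA₂⟩ := exists_rpow_majorant k
  set A : ℝ := A₂ (1 / 4) with hA
  have hA1 : 1 ≤ A := by
    have h := hA₂ 2 (1 / 4) (by norm_num) 1 le_rfl
    simp at h
    rw [hA]
    -- `f(1) = 1 ≤ A₂(1/4) · 1`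
    have : (if Nat.Coprime 1 (primesProdBelow 2) then (1 : ℝ) else 0) = 1 := by simp
    simpa [this] using h
  refine ⟨2 * Cb + A * (2 * x₀) ^ ((5 : ℝ) / 4) * (8 / 3) + 1, by positivity, ?_⟩
  intro X z hz hzX
  have hz1 : 1 < z := by linarith
  have hz0 : 0 < z := by linarith
  have hX4 : 4 ≤ X := by nlinarith
  have hX1 : 1 < X := by linarith
  have hX0 : 0 < X := by linarith
  have hlogX : 0 < Real.log X := Real.log_pos hX1
  have hlogz : 0 < Real.log z := Real.log_pos hz1
  have hsqrt : z ≤ Real.sqrt X := by rw [Real.le_sqrt hz0.le hX0.le]; exact hzX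
  have hsqrtX : Real.sqrt X ≤ X := by
    rw [Real.sqrt_le_left (by linarith)]; nlinarith
  set T : ℝ := max x₀ (Real.sqrt X) with hT
  have hT1 : 1 ≤ T := le_trans hx₀ (le_max_left _ _)
  have hT0 : 0 < T := by linarith
  set f : ℕ → ℝ := fun n => ((σ 0 n : ℕ) : ℝ) ^ k * (if n.Coprime (primesProdBelow z) then (1 : ℝ) else 0)
    with hf
  have hf0 : ∀ n, 0 ≤ f n := fun n => by
    simp only [hf]; split_ifs <;> positivity
  set E : ℝ := (Real.log X / Real.log z) ^ (2 ^ k) with hE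
  have hE1 : 1 ≤ E := one_le_pow₀ (by rw [le_div_iff₀ hlogz, one_mul]; exact Real.log_le_log hz0 (by linarith))
  -- the block indicator decomposition
  set good : ℕ → Prop := fun j => T ≤ X / 2 ^ (j + 1) with hgood
  set blk : ℕ → ℕ → Prop := fun j n => X / 2 ^ (j + 1) < (n : ℝ) ∧ (n : ℝ) ≤ X / 2 ^ j with hblk
  have hcover : ∀ n ∈ Finset.Icc 1 ⌊X⌋₊, f n ≤
      (if (n : ℝ) ≤ 2 * T then f n else 0) +
        ∑ j ∈ Finset.range (⌊X⌋₊ + 1), (if good j ∧ blk j n then f n else 0) := by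
    intro n hn
    obtain ⟨hn1, hnX⟩ := Finset.mem_Icc.mp hn
    have hn0 : (0 : ℝ) < n := by exact_mod_cast hn1
    have hnX' : (n : ℝ) ≤ X := (Nat.cast_le.mpr hnX).trans (Nat.floor_le hX0.le)
    have hsum0 : 0 ≤ ∑ j ∈ Finset.range (⌊X⌋₊ + 1), (if good j ∧ blk j n then f n else 0) :=
      Finset.sum_nonneg fun j _ => by split_ifs <;> [exact hf0 n; exact le_rfl]
    by_cases h2T : (n : ℝ) ≤ 2 * T
    · rw [if_pos h2T]; linarith
    · rw [if_neg h2T, zero_add]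
      -- find the dyadic block of `n`
      have hXn : 1 ≤ X / n := by rw [le_div_iff₀ hn0, one_mul]; exact hnX'
      obtain ⟨j, hj1, hj2⟩ := exists_nat_pow_near hXn one_lt_two
      have hblkj : blk j n := by
        constructor
        · show X / 2 ^ (j + 1) < (n : ℝ)
          rw [div_lt_iff₀ (by positivity)]
          rw [div_lt_iff₀ hn0] at hj2
          linarith
        · show (n : ℝ) ≤ X / 2 ^ j
          rw [le_div_iff₀ (by positivity)]
          rw [le_div_iff₀ hn0] at hj1
          linarith
      have hgoodj : good j := by
        show T ≤ X / 2 ^ (j + 1)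
        have h1 : (n : ℝ) ≤ X / 2 ^ j := hblkj.2
        rw [le_div_iff₀ (by positivity)]
        rw [le_div_iff₀ (by positivity)] at h1
        rw [pow_succ]
        rw [not_le] at h2T
        nlinarith [pow_pos (two_pos : (0 : ℝ) < 2) j]
      have hjlt : j ∈ Finset.range (⌊X⌋₊ + 1) := by
        rw [Finset.mem_range]
        have h2j : (2 : ℝ) ^ j ≤ X := hj1.trans (div_le_self hX0.le (by exact_mod_cast hn1))
        have hjj : (j : ℝ) < 2 ^ j := by exact_mod_cast Nat.lt_two_pow_self
        have : (j : ℝ) < ⌊X⌋₊ + 1 := by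
          have := Nat.lt_floor_add_one X
          linarith
        exact_mod_cast this
      have hnn : ∀ i ∈ Finset.range (⌊X⌋₊ + 1), (0 : ℝ) ≤ (if good i ∧ blk i n then f n else 0) :=
        fun i _ => by split_ifs <;> [exact hf0 n; exact le_rfl]
      calc f n = (if good j ∧ blk j n then f n else 0) := by rw [if_pos ⟨hgoodj, hblkj⟩]
        _ ≤ ∑ j ∈ Finset.range (⌊X⌋₊ + 1), (if good j ∧ blk j n then f n else 0) :=
            Finset.single_le_sum hnn hjlt
  refine (Finset.sum_le_sum hcover).trans ?_
  rw [Finset.sum_add_distrib, Finset.sum_comm]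
  -- (1) the initial segment `n ≤ 2T`
  have hinit : ∑ n ∈ Finset.Icc 1 ⌊X⌋₊, (if (n : ℝ) ≤ 2 * T then f n else 0) ≤
      A * (2 * x₀) ^ ((5 : ℝ) / 4) * (8 / 3) * X * E / Real.log X := by
    have hterm : ∀ n ∈ Finset.Icc 1 ⌊X⌋₊, (if (n : ℝ) ≤ 2 * T then f n else 0) ≤
        (if (n : ℝ) ≤ 2 * T then A * (2 * T) ^ ((1 : ℝ) / 4) else 0) := by
      intro n hn
      obtain ⟨hn1, -⟩ := Finset.mem_Icc.mp hn
      split_ifs with h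
      · calc f n ≤ A * (n : ℝ) ^ ((1 : ℝ) / 4) := hA₂ z (1 / 4) (by norm_num) n hn1
          _ ≤ A * (2 * T) ^ ((1 : ℝ) / 4) :=
              mul_le_mul_of_nonneg_left (Real.rpow_le_rpow (Nat.cast_nonneg n) h (by norm_num)) (by linarith)
      · exact le_rfl
    refine (Finset.sum_le_sum hterm).trans ?_
    rw [← Finset.sum_filter]
    have hcard : ((Finset.Icc 1 ⌊X⌋₊).filter (fun n : ℕ => (n : ℝ) ≤ 2 * T)).card ≤ 2 * T := by
      have hsub : (Finset.Icc 1 ⌊X⌋₊).filter (fun n : ℕ => (n : ℝ) ≤ 2 * T) ⊆ Finset.Icc 1 ⌊2 * T⌋₊ := by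
        intro n hn
        rw [Finset.mem_filter, Finset.mem_Icc] at hn
        rw [Finset.mem_Icc]
        exact ⟨hn.1.1, Nat.le_floor hn.2⟩
      calc (((Finset.Icc 1 ⌊X⌋₊).filter (fun n : ℕ => (n : ℝ) ≤ 2 * T)).card : ℝ)
          ≤ (Finset.Icc 1 ⌊2 * T⌋₊).card := by exact_mod_cast Finset.card_le_card hsub
        _ = ⌊2 * T⌋₊ := by simp
        _ ≤ 2 * T := Nat.floor_le (by positivity)
    rw [Finset.sum_const, nsmul_eq_mul]
    have hTx : T ≤ x₀ * Real.sqrt X := by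
      rcases le_total x₀ (Real.sqrt X) with h | h
      · rw [hT, max_eq_right h]
        exact le_mul_of_one_le_left (Real.sqrt_nonneg X) hx₀
      · rw [hT, max_eq_left h]
        refine le_mul_of_one_le_right (by linarith) ?_
        rw [Real.le_sqrt (by norm_num) hX0.le]; linarith
    have h58 := rpow_five_eighths_le hX1
    -- `(2T) (2T)^{1/4} = (2T)^{5/4} ≤ (2x₀)^{5/4} X^{5/8}`
    have h54 : (2 * T) * (2 * T) ^ ((1 : ℝ) / 4) = (2 * T) ^ ((5 : ℝ) / 4) := by
      rw [show (5 : ℝ) / 4 = 1 + 1 / 4 by norm_num, Real.rpow_add (by linarith), Real.rpow_one]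
    have hpow : (2 * T) ^ ((5 : ℝ) / 4) ≤ (2 * x₀) ^ ((5 : ℝ) / 4) * X ^ ((5 : ℝ) / 8) := by
      have h1 : 2 * T ≤ (2 * x₀) * Real.sqrt X := by nlinarith
      calc (2 * T) ^ ((5 : ℝ) / 4) ≤ ((2 * x₀) * Real.sqrt X) ^ ((5 : ℝ) / 4) :=
            Real.rpow_le_rpow (by positivity) h1 (by norm_num)
        _ = (2 * x₀) ^ ((5 : ℝ) / 4) * (Real.sqrt X) ^ ((5 : ℝ) / 4) := Real.mul_rpow (by positivity) (Real.sqrt_nonneg X)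
        _ = (2 * x₀) ^ ((5 : ℝ) / 4) * X ^ ((5 : ℝ) / 8) := by
            rw [Real.sqrt_eq_rpow, ← Real.rpow_mul hX0.le]; norm_num
    calc (((Finset.Icc 1 ⌊X⌋₊).filter (fun n : ℕ => (n : ℝ) ≤ 2 * T)).card : ℝ) * (A * (2 * T) ^ ((1 : ℝ) / 4))
        ≤ (2 * T) * (A * (2 * T) ^ ((1 : ℝ) / 4)) := mul_le_mul_of_nonneg_right hcard (by positivity)
      _ = A * ((2 * T) * (2 * T) ^ ((1 : ℝ) / 4)) := by ring
      _ = A * (2 * T) ^ ((5 : ℝ) / 4) := by rw [h54]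
      _ ≤ A * ((2 * x₀) ^ ((5 : ℝ) / 4) * X ^ ((5 : ℝ) / 8)) := mul_le_mul_of_nonneg_left hpow (by linarith)
      _ ≤ A * ((2 * x₀) ^ ((5 : ℝ) / 4) * (8 / 3 * X / Real.log X)) := by
          refine mul_le_mul_of_nonneg_left (mul_le_mul_of_nonneg_left h58 (by positivity)) (by linarith)
      _ = A * (2 * x₀) ^ ((5 : ℝ) / 4) * (8 / 3) * X * 1 / Real.log X := by ring
      _ ≤ A * (2 * x₀) ^ ((5 : ℝ) / 4) * (8 / 3) * X * E / Real.log X := by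
          refine div_le_div_of_nonneg_right (mul_le_mul_of_nonneg_left hE1 (by positivity)) hlogX.le
  -- (2) the dyadic blocks
  have hblocks : ∑ j ∈ Finset.range (⌊X⌋₊ + 1), ∑ n ∈ Finset.Icc 1 ⌊X⌋₊, (if good j ∧ blk j n then f n else 0) ≤
      2 * Cb * X * E / Real.log X := by
    have hj : ∀ j ∈ Finset.range (⌊X⌋₊ + 1), ∑ n ∈ Finset.Icc 1 ⌊X⌋₊, (if good j ∧ blk j n then f n else 0) ≤
        Cb * X * E / Real.log X * (1 / 2) ^ j := by
      intro j _
      by_cases hg : good j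
      · -- Shiu on the block `(x', 2x']`, `x' = X/2^{j+1} ≥ T`
        set x' : ℝ := X / 2 ^ (j + 1) with hx'
        have hx'T : T ≤ x' := hg
        have hx'0 : 0 < x' := by positivity
        have hzx' : z ≤ x' := hsqrt.trans ((le_max_right _ _).trans hx'T)
        have hx₀x' : x₀ ≤ x' := (le_max_left _ _).trans hx'T
        have hbl := hblock z x' hx₀x' hz1 hzx'
        have hsub : ∑ n ∈ Finset.Icc 1 ⌊X⌋₊, (if good j ∧ blk j n then f n else 0) ≤
            ∑ n ∈ (Finset.Icc 1 ⌊x' + x'⌋₊).filter (fun n : ℕ => x' < n), f n := by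
          rw [← Finset.sum_filter]
          refine Finset.sum_le_sum_of_subset_of_nonneg ?_ fun n _ _ => hf0 n
          intro n hn
          rw [Finset.mem_filter, Finset.mem_Icc] at hn
          obtain ⟨⟨hn1, -⟩, -, hb1, hb2⟩ := hn
          rw [Finset.mem_filter, Finset.mem_Icc]
          refine ⟨⟨hn1, Nat.le_floor ?_⟩, hb1⟩
          have : x' + x' = X / 2 ^ j := by
            rw [hx', pow_succ]
            field_simp
            ring
          rw [this]; exact hb2
        refine hsub.trans (hbl.trans ?_)
        -- `x' (log x'/log z)^{2^k}/log x' ≤ 2 x' E/log X`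
        have hlogx'lo : Real.log X / 2 ≤ Real.log x' := by
          have h1 : Real.sqrt X ≤ x' := (le_max_right _ _).trans hx'T
          have h2 := Real.log_le_log (Real.sqrt_pos.mpr hX0) h1
          rw [Real.log_sqrt hX0.le] at h2
          exact h2
        have hlogx'0 : 0 < Real.log x' := lt_of_lt_of_le (by positivity) hlogx'lo
        have hlogx'hi : Real.log x' ≤ Real.log X := Real.log_le_log hx'0 (by
          rw [hx']; exact div_le_self hX0.le (one_le_pow₀ (by norm_num)))
        have hE' : (Real.log x' / Real.log z) ^ (2 ^ k) ≤ E :=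
          pow_le_pow_left₀ (by positivity) (div_le_div_of_nonneg_right hlogx'hi hlogz.le) _
        calc Cb * x' * (Real.log x' / Real.log z) ^ (2 ^ k) / Real.log x'
            ≤ Cb * x' * E / (Real.log X / 2) := by
              gcongr
          _ = Cb * X * E / Real.log X * (1 / 2) ^ j := by
              rw [hx', pow_succ, one_div, inv_pow]
              field_simp
      · have : ∑ n ∈ Finset.Icc 1 ⌊X⌋₊, (if good j ∧ blk j n then f n else 0) = 0 :=
          Finset.sum_eq_zero fun n _ => by rw [if_neg (fun h => hg h.1)]
        rw [this]; positivity
    refine (Finset.sum_le_sum hj).trans ?_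
    rw [← Finset.mul_sum]
    have hgeom : ∑ j ∈ Finset.range (⌊X⌋₊ + 1), ((1 : ℝ) / 2) ^ j ≤ 2 := by
      rw [geom_sum_eq (by norm_num : (1 : ℝ) / 2 ≠ 1)]
      have h0 : (0 : ℝ) ≤ ((1 : ℝ) / 2) ^ (⌊X⌋₊ + 1) := by positivity
      have : (((1 : ℝ) / 2) ^ (⌊X⌋₊ + 1) - 1) / ((1 : ℝ) / 2 - 1) = 2 * (1 - ((1 : ℝ) / 2) ^ (⌊X⌋₊ + 1)) := by
        field_simp
        ring
      rw [this]
      nlinarith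
    calc Cb * X * E / Real.log X * ∑ j ∈ Finset.range (⌊X⌋₊ + 1), ((1 : ℝ) / 2) ^ j
        ≤ Cb * X * E / Real.log X * 2 := mul_le_mul_of_nonneg_left hgeom (by positivity)
      _ = 2 * Cb * X * E / Real.log X := by ring
  have hE0 : 0 ≤ X * E / Real.log X := by positivity
  calc ∑ n ∈ Finset.Icc 1 ⌊X⌋₊, (if (n : ℝ) ≤ 2 * T then f n else 0) +
        ∑ j ∈ Finset.range (⌊X⌋₊ + 1), ∑ n ∈ Finset.Icc 1 ⌊X⌋₊, (if good j ∧ blk j n then f n else 0)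
      ≤ A * (2 * x₀) ^ ((5 : ℝ) / 4) * (8 / 3) * X * E / Real.log X + 2 * Cb * X * E / Real.log X :=
        add_le_add hinit hblocks
    _ ≤ (2 * Cb + A * (2 * x₀) ^ ((5 : ℝ) / 4) * (8 / 3) + 1) * X * E / Real.log X := by
        have : A * (2 * x₀) ^ ((5 : ℝ) / 4) * (8 / 3) * X * E / Real.log X + 2 * Cb * X * E / Real.log X =
            (2 * Cb + A * (2 * x₀) ^ ((5 : ℝ) / 4) * (8 / 3)) * (X * E / Real.log X) := by ring
        rw [this, show (2 * Cb + A * (2 * x₀) ^ ((5 : ℝ) / 4) * (8 / 3) + 1) * X * E / Real.log X =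
          (2 * Cb + A * (2 * x₀) ^ ((5 : ℝ) / 4) * (8 / 3) + 1) * (X * E / Real.log X) by ring]
        nlinarith

end RoughMoments

end Literature.NumberTheory.Sieve
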